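import Summits.BirchSwinnertonDyer.Rank1Residual.Additive.N10LowerHalfStatements
import Summits.BirchSwinnertonDyer.Rank1Residual.Additive.GordCharLeadingTerm
import Summits.BirchSwinnertonDyer.Rank1Residual.Additive.CycLeadingTermDvd
import HarnessLib

/-!
# Class N10 — the Miller-currency conjectures `N10.LowerHalf*` FROM the Iwasawa-currency `T = 0`
# lower inputs of record, cell by cell (cell `b2b-bsdres`, lane CLASS-CLOSURE, seat cc-typer-2, team
# n1011 sub-target T-N10; n1011 lead's DEDUP RULING #2, 2026-08-21T05:04Z)

HONEST FRAMING (cell `b2b-bsdres`, run/shared/lean/b2b/bsd-rank1-residual/, verbatim in every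
file): the goal of the cell is to DELETE the COMBINATION-SHAPED residual classes of the
Birch–Swinnerton-Dyer formula for ALL analytic-rank `≤ 1` elliptic curves over `ℚ` — "full BSD
formula for every rank `≤ 1` curve in class `C`" assembled STRICTLY from published theorems — so
that the rank-`≤ 1` remainder becomes exactly the CONSTRUCTION-SHAPED classes, which are TYPED
(missing-input `Prop`s), NOT attempted. This is not "finishing BSD". Lane CLASS-CLOSURE: research
routes, no claim beyond the stated classes; census output = EVIDENCE, never a Literature fact; N10
stays CONSTRUCTION; NOTHING is booked. Theorems only (no definition, no named fact); every published
input is an explicit named-fact binder (referee-1 R1).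

## What this file does (n1011 lead, LEAD RULINGS #2: "cc-typer-2: `N10.LowerHalf*` (p249263) = the
class-level conjecture defs, each with the equivalence to '∀ pairs in cell, MissingLowerBoundAt' and
on (G-ord, `e = 2`) r0 the implication from `CycLowerLeadingTermAt`")

* §1 The unfolding equivalences: each of `N10.LowerHalf`, `N10.LowerHalfM`, `N10.LowerHalfGordTwo`,
  `N10.LowerHalfGordHigher` (`Additive/N10LowerHalfStatements`, p249263) IS, by `Iff.rfl`,
  "∀ pairs of the cell with `r_an = 0`, `Typed.MissingLowerBoundAt W p`".
* §2 Cell (M): `N10.LowerHalfM` follows from the `∀`-closure over the cell of the typed `T = 0`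
  main-conjecture divisibility `CycLeadingTermDvdAt W p` (seat n1011-p18, `Additive/CycLeadingTermDvd`)
  — consumer of record `missingLowerBoundAt_rankZero_of_potMult_of_cycLeadingTermDvd` (Delbourgo 1998
  Prop. 4 + §2.2 Lemma (ii) EXACT on (M), named fact `hDelX`; GZK; modularity), every odd `p`, no
  image hypothesis. The ONE Iwasawa-currency input OF RECORD is additive-p2's `CycLowerLeadingTermAt`
  (`Additive/GordCharLeadingTerm`, quantified over GENERATORS of `char_Λ X`); `CycLeadingTermDvdAt`
  (quantified over all ELEMENTS) implies it trivially (`N10.cycLowerLeadingTermAt_of_cycLeadingTermDvdAt`;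
  the converse needs principality of `char_Λ X` for every dual datum and is n1011-p18's to state).
* §3 Cells (G-ord, `e = 2`) and (G-ord, `e ∈ {3,4,6}`): at `p ≥ 5`, non-CM, off the ANOMALOUS rows
  (`Delbourgo2002.ReductionNonAnomalous W p`: the local factor `ℓ_p(E)` of Delbourgo, JNT 95 (2002)
  p. 39 is `1`), the lower half at the pair follows from `CycLowerLeadingTermAt W p` through
  additive-p2's core `exists_padicVal_shaAn_of_cycLowerLeadingTerm` (Delbourgo 2002 Main Theorem
  (A)+(B), named fact A175 `Delbourgo2002.mainTheorem`; GZK; modularity):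
  `N10.missingLowerBoundAt_of_cycLowerLeadingTerm_of_nonAnomalous`; hence the (G-ord) cells of
  `N10.LowerHalf` restricted to {`p ≥ 5`, non-CM, non-anomalous} follow from the `∀`-closure of the
  decl of record (`N10.lowerHalfGord_of_forall_cycLowerLeadingTerm_of_nonAnomalous`). On the anomalous
  rows the same input leaves a slack `ℓ ∣ p²` (`ord_p #Ш_an ≤ ord_p #Ш + 2`,
  `N10.padicValRat_shaAn_le_add_two_of_cycLowerLeadingTerm`); at `p = 3` the (G-ord) cell is n1011's
  `T-N10b`/`T-N10-low` matter (Delbourgo 1998 (G) needs `p ≥ 5` in A175's typing).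

So, binder for binder: N10 = [the `T = 0` lower divisibility of Delbourgo's Main Conjecture (G)/(M)]
on (M) (every odd `p`) and on (G-ord) ∖ {anomalous, CM, `p = 3`}; the complement inside (G-ord) keeps
the Miller-currency statement as its typed residue. Nothing here is a theorem about a single curve's
`Ш` without the typed input as hypothesis.

References: D. Delbourgo, Compositio Math. 113 (1998) Prop. 4 (p. 144), §2.2 Lemma (ii) (p. 139), Main
Conjecture (p. 151) [Delbourgo1998]; D. Delbourgo, J. Number Theory 95 (2002) 38–71, Main Theorem
(A), (B) (p. 40), `ℓ_p(E)` (p. 39) [Delbourgo2002]; R. L. Miller, LMS J. Comput. Math. 14 (2011)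
Def. 1.1 [Miller2011LMS]; cells/n1011/PLAN.md LEAD RULINGS #2 (2026-08-21T05:04Z).
-/

noncomputable section

open scoped Classical

open WeierstrassCurve Literature.NumberTheory.EllipticCurves
  Literature.NumberTheory.EllipticCurves.ModularForms
  Literature.NumberTheory.EllipticCurves.Rank1Residual
  Literature.NumberTheory.EllipticCurves.Rank1Residual.Typed

namespace Summit.BirchSwinnertonDyer.Rank1Residual.Additive

/-! ## §1 Each class conjecture IS "∀ pairs in the cell, `MissingLowerBoundAt`" (unfolding) -/

/-- `N10.LowerHalf` unfolds to "∀ pairs of the N10 locus with `r_an = 0`, the lower half". -/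
theorem N10.lowerHalf_iff_forall :
    N10.LowerHalf ↔
      ∀ (W : WeierstrassCurve ℚ) [W.IsElliptic] [W.IsGloballyMinimal] (p : ℕ) [Fact p.Prime],
        W.analyticRank = 0 → N10.Locus W p → MissingLowerBoundAt W p :=
  Iff.rfl

/-- `N10.LowerHalfM` unfolds to "∀ pairs of cell (M) with `r_an = 0`, the lower half". -/
theorem N10.lowerHalfM_iff_forall :
    N10.LowerHalfM ↔
      ∀ (W : WeierstrassCurve ℚ) [W.IsElliptic] [W.IsGloballyMinimal] (p : ℕ) [Fact p.Prime],
        W.analyticRank = 0 → N10.CellM W p → MissingLowerBoundAt W p :=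
  Iff.rfl

/-- `N10.LowerHalfGordTwo` unfolds to "∀ pairs of cell (G-ord, `e = 2`) with `r_an = 0`, the lower half". -/
theorem N10.lowerHalfGordTwo_iff_forall :
    N10.LowerHalfGordTwo ↔
      ∀ (W : WeierstrassCurve ℚ) [W.IsElliptic] [W.IsGloballyMinimal] (p : ℕ) [Fact p.Prime],
        W.analyticRank = 0 → N10.CellGordTwo W p → MissingLowerBoundAt W p :=
  Iff.rfl

/-- `N10.LowerHalfGordHigher` unfolds to "∀ pairs of cell (G-ord, `e ≠ 2`) with `r_an = 0`, the lower half". -/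
theorem N10.lowerHalfGordHigher_iff_forall :
    N10.LowerHalfGordHigher ↔
      ∀ (W : WeierstrassCurve ℚ) [W.IsElliptic] [W.IsGloballyMinimal] (p : ℕ) [Fact p.Prime],
        W.analyticRank = 0 → N10.CellGordHigher W p → MissingLowerBoundAt W p :=
  Iff.rfl

/-! ## §2 Cell (M): `N10.LowerHalfM` from the `T = 0` main-conjecture divisibility -/

section CellM

variable (W : WeierstrassCurve ℚ) [W.IsElliptic] [W.IsGloballyMinimal] (p : ℕ) [hp : Fact p.Prime]

omit [W.IsElliptic] [W.IsGloballyMinimal] in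
/-- The element-wise `T = 0` divisibility `CycLeadingTermDvdAt` (n1011-p18) implies the generator-wise
decl of record `CycLowerLeadingTermAt` (additive-p2): a generator is an element of the ideal it
generates. (The converse needs `char_Λ X` principal for every dual datum; not stated here.) [folklore] -/
theorem N10.cycLowerLeadingTermAt_of_cycLeadingTermDvdAt (h : CycLeadingTermDvdAt W p) :
    CycLowerLeadingTermAt W p := by
  intro κ γ hκ hγ hγ' D f hf
  obtain ⟨z, q, hLq, hf0⟩ := h κ γ hκ hγ hγ' D f (by rw [hf]; exact Ideal.mem_span_singleton_self f)
  exact ⟨q, hLq, z, hf0⟩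

/-- **Cell (M), per pair**: at an odd additive potentially multiplicative `p` in analytic rank `0`,
`CycLeadingTermDvdAt W p` gives the lower half (n1011-p18's consumer of record
`missingLowerBoundAt_rankZero_of_potMult_of_cycLeadingTermDvd`, inputs Delbourgo 1998 Prop. 4 /
Lemma (ii) EXACT on (M) `hDelX`, GZK, modularity) — restated on the N10 cell predicate.
[cite: Delbourgo1998, Prop. 4 (p. 144), §2.2 Lemma (ii) (p. 139), Main Conjecture (p. 151)] -/
theorem N10.missingLowerBoundAt_cellM_of_cycLeadingTermDvd
    (hDelX : Delbourgo1998.prop4_rankZero_constantCoeff_eq_unit_mul_of_potMult)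
    (hGZK : rank_eq_analyticRank_of_analyticRank_le_one) (hmod : hasEntireLFunction_rat)
    (hr : W.analyticRank = 0) (hc : N10.CellM W p) (hDvd : CycLeadingTermDvdAt W p) :
    MissingLowerBoundAt W p :=
  missingLowerBoundAt_rankZero_of_potMult_of_cycLeadingTermDvd W p hDelX hGZK hmod hc.1 hc.2.1 hc.2.2 hr
    hDvd

end CellM

/-- **Conjecture N10(M) ⟸ the `∀`-closure over cell (M) of the `T = 0` main-conjecture divisibility**
(every odd `p`, both images; Delbourgo 1998 Prop. 4 / Lemma (ii) EXACT `hDelX`, GZK, modularity).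
[cite: Delbourgo1998, Prop. 4 (p. 144), §2.2 Lemma (ii) (p. 139), Main Conjecture (p. 151)] -/
theorem N10.lowerHalfM_of_forall_cycLeadingTermDvd
    (hDelX : Delbourgo1998.prop4_rankZero_constantCoeff_eq_unit_mul_of_potMult)
    (hGZK : rank_eq_analyticRank_of_analyticRank_le_one) (hmod : hasEntireLFunction_rat)
    (hDvd : ∀ (W : WeierstrassCurve ℚ) [W.IsElliptic] [W.IsGloballyMinimal] (p : ℕ) [Fact p.Prime],
      W.analyticRank = 0 → N10.CellM W p → CycLeadingTermDvdAt W p) :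
    N10.LowerHalfM := fun W _ _ p _ hr hc ↦
  N10.missingLowerBoundAt_cellM_of_cycLeadingTermDvd W p hDelX hGZK hmod hr hc (hDvd W p hr hc)

/-! ## §3 Cells (G-ord): the lower half from the decl of record `CycLowerLeadingTermAt`, off the
anomalous rows, `p ≥ 5`, non-CM -/

section CellGord

variable (W : WeierstrassCurve ℚ) [W.IsElliptic] [W.IsGloballyMinimal] (p : ℕ) [hp : Fact p.Prime]

/-- **(G-ord), per pair, with the anomalous slack**: at an additive (G)-ordinary `p ≥ 5` of a non-CM
curve in analytic rank `0`, `CycLowerLeadingTermAt W p` + Delbourgo 2002 (A)+(B) (`hDel` = A175) + GZK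
+ modularity give `#Ш_an = q` with `ord_p q ≤ ord_p #Ш(E) + ord_p ℓ`, `ℓ ∣ p²` Delbourgo's local
factor (additive-p2's core `exists_padicVal_shaAn_of_cycLowerLeadingTerm`, cofactor valuation `≥ 0`
dropped). [cite: Delbourgo2002, Theorem (A), (B) (p. 40), p. 39 (ℓ_p(E))] -/
theorem N10.padicValRat_shaAn_le_add_of_cycLowerLeadingTerm (hDel : Delbourgo2002.mainTheorem)
    (hGZK : rank_eq_analyticRank_of_analyticRank_le_one) (hmod : hasEntireLFunction_rat)
    (hp5 : 5 ≤ p) (hcm : ¬ W.HasCM) (hadd : Addv W p) (hG : TypeGOrd W p)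
    (hr : W.analyticRank = 0) (hLow : CycLowerLeadingTermAt W p) :
    ∃ q : ℚ, shaAn W = (q : ℂ) ∧ ∃ ℓ : ℕ, ℓ ∣ p ^ 2 ∧
      (Delbourgo2002.ReductionNonAnomalous W p → ℓ = 1) ∧
      padicValRat p q ≤ padicValNat p W.shaOrder + padicValNat p ℓ := by
  obtain ⟨q, hq, -, c, ℓ, -, hℓp, hℓ1, hval⟩ :=
    exists_padicVal_shaAn_of_cycLowerLeadingTerm W p hDel hGZK hmod hp5 hcm hadd hG hr hLow
  have hc : 0 ≤ ((c : ℤ_[p]) : ℚ_[p]).valuation := PadicInt.valuation_coe_nonneg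
  exact ⟨q, hq, ℓ, hℓp, hℓ1, by linarith⟩

/-- The slack is at most `2`: `ord_p #Ш_an ≤ ord_p #Ш(E) + 2` on every (G-ord) row (`ℓ ∣ p²`).
[cite: Delbourgo2002, Theorem (A), (B) (p. 40), p. 39 (ℓ_p(E))] -/
theorem N10.padicValRat_shaAn_le_add_two_of_cycLowerLeadingTerm (hDel : Delbourgo2002.mainTheorem)
    (hGZK : rank_eq_analyticRank_of_analyticRank_le_one) (hmod : hasEntireLFunction_rat)
    (hp5 : 5 ≤ p) (hcm : ¬ W.HasCM) (hadd : Addv W p) (hG : TypeGOrd W p)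
    (hr : W.analyticRank = 0) (hLow : CycLowerLeadingTermAt W p) :
    ∃ q : ℚ, shaAn W = (q : ℂ) ∧ padicValRat p q ≤ padicValNat p W.shaOrder + 2 := by
  obtain ⟨q, hq, ℓ, hℓp, -, hle⟩ :=
    N10.padicValRat_shaAn_le_add_of_cycLowerLeadingTerm W p hDel hGZK hmod hp5 hcm hadd hG hr hLow
  have hpP : p.Prime := hp.out
  have hvℓ : padicValNat p ℓ ≤ 2 :=
    (Nat.pow_dvd_pow_iff_le_right hpP.one_lt).mp (pow_padicValNat_dvd.trans hℓp)
  refine ⟨q, hq, hle.trans ?_⟩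
  have : (padicValNat p ℓ : ℤ) ≤ 2 := by exact_mod_cast hvℓ
  linarith

/-- **(G-ord), per pair, OFF the anomalous rows: the lower half from the decl of record.** At an
additive (G)-ordinary `p ≥ 5` of a non-CM curve with `r_an = 0` and NON-ANOMALOUS good reduction over
the (G)-field (`Delbourgo2002.ReductionNonAnomalous W p`, so `ℓ_p(E) = 1`), `CycLowerLeadingTermAt W p`
+ Delbourgo 2002 (A)+(B) + GZK + modularity give `Typed.MissingLowerBoundAt W p`.
[cite: Delbourgo2002, Theorem (A), (B) (p. 40), p. 39 (ℓ_p(E))] [cite: Miller2011LMS, Def. 1.1] -/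
theorem N10.missingLowerBoundAt_of_cycLowerLeadingTerm_of_nonAnomalous
    (hDel : Delbourgo2002.mainTheorem)
    (hGZK : rank_eq_analyticRank_of_analyticRank_le_one) (hmod : hasEntireLFunction_rat)
    (hp5 : 5 ≤ p) (hcm : ¬ W.HasCM) (hadd : Addv W p) (hG : TypeGOrd W p)
    (hr : W.analyticRank = 0) (hna : Delbourgo2002.ReductionNonAnomalous W p)
    (hLow : CycLowerLeadingTermAt W p) : MissingLowerBoundAt W p := by
  obtain ⟨q, hq, ℓ, -, hℓ1, hle⟩ :=
    N10.padicValRat_shaAn_le_add_of_cycLowerLeadingTerm W p hDel hGZK hmod hp5 hcm hadd hG hr hLow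
  have hℓ : ℓ = 1 := hℓ1 hna
  subst hℓ
  refine ⟨q, hq, ?_⟩
  simpa using hle

end CellGord

/-- **The (G-ord) cells of N10, restricted to {`p ≥ 5`, non-CM, non-anomalous}, ⟸ the `∀`-closure of
the decl of record `CycLowerLeadingTermAt` over the (G)-ordinary additive rows** (Delbourgo 2002
(A)+(B) `hDel`, GZK, modularity). For the higher-defect cell `p ≥ 5` is automatic
(`N10.five_le_of_cellGordHigher`). The complement (anomalous ∪ CM ∪ `p = 3`) keeps the Miller-currency
statement `N10.LowerHalfGordTwo/GordHigher` as its typed residue. [cite: Delbourgo2002, Theorem (A), (B) (p. 40)]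
[cite: Miller2011LMS, Def. 1.1] -/
theorem N10.lowerHalfGord_of_forall_cycLowerLeadingTerm_of_nonAnomalous
    (hDel : Delbourgo2002.mainTheorem)
    (hGZK : rank_eq_analyticRank_of_analyticRank_le_one) (hmod : hasEntireLFunction_rat)
    (hLow : ∀ (W : WeierstrassCurve ℚ) [W.IsElliptic] [W.IsGloballyMinimal] (p : ℕ) [Fact p.Prime],
      W.analyticRank = 0 → p ≠ 2 → Addv W p → TypeGOrd W p → CycLowerLeadingTermAt W p) :
    ∀ (W : WeierstrassCurve ℚ) [W.IsElliptic] [W.IsGloballyMinimal] (p : ℕ) [Fact p.Prime],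
      W.analyticRank = 0 → (N10.CellGordTwo W p ∨ N10.CellGordHigher W p) → 5 ≤ p → ¬ W.HasCM →
      Delbourgo2002.ReductionNonAnomalous W p → MissingLowerBoundAt W p := by
  intro W _ _ p _ hr hc hp5 hcm hna
  have h3 : p ≠ 2 ∧ Addv W p ∧ TypeGOrd W p := by
    rcases hc with hc | hc
    · exact ⟨hc.1, hc.2.1, hc.2.2.1⟩
    · exact ⟨hc.1, hc.2.1, hc.2.2.1⟩
  exact N10.missingLowerBoundAt_of_cycLowerLeadingTerm_of_nonAnomalous W p hDel hGZK hmod hp5 hcm h3.2.1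
    h3.2.2 hr hna (hLow W p hr h3.1 h3.2.1 h3.2.2)

/-- Same, with the element-wise input `CycLeadingTermDvdAt` (n1011-p18) in place of the decl of record
(via `N10.cycLowerLeadingTermAt_of_cycLeadingTermDvdAt`). [cite: Delbourgo2002, Theorem (A), (B) (p. 40)] -/
theorem N10.lowerHalfGord_of_forall_cycLeadingTermDvd_of_nonAnomalous
    (hDel : Delbourgo2002.mainTheorem)
    (hGZK : rank_eq_analyticRank_of_analyticRank_le_one) (hmod : hasEntireLFunction_rat)
    (hDvd : ∀ (W : WeierstrassCurve ℚ) [W.IsElliptic] [W.IsGloballyMinimal] (p : ℕ) [Fact p.Prime],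
      W.analyticRank = 0 → p ≠ 2 → Addv W p → TypeGOrd W p → CycLeadingTermDvdAt W p) :
    ∀ (W : WeierstrassCurve ℚ) [W.IsElliptic] [W.IsGloballyMinimal] (p : ℕ) [Fact p.Prime],
      W.analyticRank = 0 → (N10.CellGordTwo W p ∨ N10.CellGordHigher W p) → 5 ≤ p → ¬ W.HasCM →
      Delbourgo2002.ReductionNonAnomalous W p → MissingLowerBoundAt W p :=
  N10.lowerHalfGord_of_forall_cycLowerLeadingTerm_of_nonAnomalous hDel hGZK hmod
    fun W _ _ p _ hr hp2 hadd hG ↦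
      N10.cycLowerLeadingTermAt_of_cycLeadingTermDvdAt W p (hDvd W p hr hp2 hadd hG)

end Summit.BirchSwinnertonDyer.Rank1Residual.Additive

end
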